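import Summits.BirchSwinnertonDyer.Rank1Residual.Additive.CongruentLambdaShiftOfGVTorsionIso
import HarnessLib

/-!
# The typed δ-input `RamifiedLineKummerEqAt W p` DISPLAYED as its bridge hypotheses: the two
# inclusions (Greenberg ⟹ Kummer = team n1011 row T-RD-Δ-K's kernel half; Kummer ⟹ Greenberg) and
# the uniqueness of the ramified ordinary line (cell `b2b-bsdres`, lane CLASS-CLOSURE, seat cc-typer-2;
# team n1011 lead R5-46 "ONE currency line with p05: adapt the def or display a bridge hypothesis")

HONEST FRAMING (cell `b2b-bsdres`, run/shared/lean/b2b/bsd-rank1-residual/, verbatim in every file):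
the goal of the cell is to DELETE the COMBINATION-SHAPED residual classes of the Birch–Swinnerton-Dyer
formula for ALL analytic-rank `≤ 1` elliptic curves over `ℚ` — assembled STRICTLY from published
theorems — so that the rank-`≤ 1` remainder becomes exactly the CONSTRUCTION-SHAPED classes, which are
TYPED (missing-input `Prop`s), NOT attempted. This is not "finishing BSD". Team n1011 / lane
CLASS-CLOSURE: research routes; no claim beyond stated classes; census output = EVIDENCE, never a
Literature fact; RESIDUAL-MAP marks UNCHANGED; nothing is booked by this file. Theorems only: NO
definition, NO named fact, NO conjecture node.

WHAT. `Additive.RamifiedLineKummerEqAt W p` (`CongruentLambdaShiftOfGVTorsionIso.lean` §0) is the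
per-curve binder of the GV composed-citation record
`GreenbergVatsal2000.muLambdaAlg_transfer_of_torsionIso_potOrd_of_not_dvd_torsionOrder`: for every
cyclotomic `κ`, the place `v ∋ p` and EVERY ramified ordinary line `L` at `v`,
`L.greenbergKer (ker κ) = W.localKerOver p (ker κ) ℚ_v` — an EQUALITY (the record moves `μ`, `λ` and
the `[p]`-torsion count between the classical Selmer group, where the dual data live, and GV's datum
Selmer group, where Props. (2.3)/(2.8) live; one inclusion does not transport invariants) over ALL
lines (the consumers' lines are `∃`-bound, `exists_epwLineData_of_goodOrd_pStar_twist`). Team n1011's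
row T-RD-Δ-K (seat p05, `Additive/GreenbergKummerTwistDescentGeom.lean`,
`greenbergKer_twistMap_geomTransport_le_localKerOver`) proves, for a twist model `W = C • V^{(c)}` of
a good-ordinary `V`, the inclusion `≤` (Greenberg ⟹ Kummer) in THIS currency (GV's non-strict
`greenbergKer` at the bottom level `ker κ`) for ONE datum, `twistMap (reductionDatum V …) t`. This file
displays, as theorems with explicit hypotheses and no new names, exactly what separates that theorem
from the binder:
* `ramifiedLineKummerEqAt_of_forall_le_of_forall_ge` — the two inclusions for all ramified lines;
* `ramifiedLineKummerEqAt_of_plus_unique_of_datum` — (B2) UNIQUENESS of the line (`L.plus = L'.plus`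
  for any two ramified ordinary lines at `v`; LIT-INPUTS-P3 §42 (δ1)(ii): "a five-line uniqueness
  READING, kernel-sized" — it also dissolves p05's psiQ-vs-`twistPrimaryEquiv` seam, both transports
  producing ramified ordinary lines) + the two inclusions for ONE ramified datum `L₀` (p05's `≤`;
  (B1) the converse `W.localKerOver ≤ L₀.greenbergKer`, NOT X2's `localKerOver_le_greenbergKer`
  verbatim — its Kummer-compatibility hypothesis fails at a ramified line, where a tame inertia
  element moves a `D`-non-trivial torsion point; route = twist transport at level `ker κ ⊓ Gal(ℚ̄/K)`
  + X2's lemma on `V` + ascent, kernel work);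
* `LocalDatum.eq_of_plus_eq` — a local datum is determined by its `plus` (so uniqueness of `plus`
  is uniqueness of the datum and of its `greenbergKer`).
Nothing is asserted; (B1)/(B2) are NAMED here as hypotheses for the lead to deal, not proved.

References: Greenberg–Vatsal 2000 §2 p. 16 (`L_𝔭`), p. 26 [GreenbergVatsal2000]; Greenberg LNM 1716
Prop. 2.4 [GreenbergLNM1716]; cells/n1011/PLAN.md R5-46; cells/n1011/LIT-INPUTS-P3.md §42 (δ1)(ii);
HOME/INBOX 2026-08-21T11:45Z (p05 GEN 3, F5/F6 end theorem and the seam).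
-/

set_option autoImplicit false

noncomputable section

open scoped Classical NumberField

open NumberField IsDedekindDomain Field WeierstrassCurve
  Literature.NumberTheory.GaloisRepresentations
  Literature.NumberTheory.EllipticCurves
  Literature.NumberTheory.EllipticCurves.GreenbergSelmer
  Literature.NumberTheory.EllipticCurves.EmertonPollackWeston2006

namespace Literature.NumberTheory.EllipticCurves.GreenbergSelmer.LocalDatum

universe u

/-- A local datum is determined by its subgroup `plus` (the stability field is a proposition).
[folklore] -/
theorem eq_of_plus_eq {K : Type u} [Field K] [NumberField K] {M : Type u} [AddCommGroup M]
    [DistribMulAction (absoluteGaloisGroup K) M] {v : HeightOneSpectrum (𝓞 K)}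
    {L L' : LocalDatum K M v} (h : L.plus = L'.plus) : L = L' := by
  cases L; cases L'
  cases h
  rfl

end Literature.NumberTheory.EllipticCurves.GreenbergSelmer.LocalDatum

namespace Summit.BirchSwinnertonDyer.Rank1Residual.Additive

variable (W : WeierstrassCurve ℚ) (p : ℕ) [Fact p.Prime]

/-- **`RamifiedLineKummerEqAt` from the two inclusions, for all ramified lines.** If for every
cyclotomic `κ`, `v ∋ p` and every ramified ordinary line `L` at `v` both `L.greenbergKer (ker κ) ≤
W.localKerOver p (ker κ) ℚ_v` (Greenberg ⟹ Kummer; the currency of T-RD-Δ-K's end theorem) and the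
converse hold, then `RamifiedLineKummerEqAt W p`. Bookkeeping (`le_antisymm`). [folklore] -/
theorem ramifiedLineKummerEqAt_of_forall_le_of_forall_ge
    (hge : ∀ (κ : ZpExtension ℚ p), κ.IsCyclotomic →
      ∀ (v : HeightOneSpectrum (𝓞 ℚ)) (hv : ((p : ℕ) : 𝓞 ℚ) ∈ v.asIdeal)
        (L : LocalDatum ℚ (W.geomPrimaryTorsion p) v), IsRamifiedOrdinaryLine W p L →
        L.greenbergKer κ.kerSubgroup ≤ W.localKerOver p κ.kerSubgroup (v.adicCompletion ℚ))
    (hle : ∀ (κ : ZpExtension ℚ p), κ.IsCyclotomic →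
      ∀ (v : HeightOneSpectrum (𝓞 ℚ)) (hv : ((p : ℕ) : 𝓞 ℚ) ∈ v.asIdeal)
        (L : LocalDatum ℚ (W.geomPrimaryTorsion p) v), IsRamifiedOrdinaryLine W p L →
        W.localKerOver p κ.kerSubgroup (v.adicCompletion ℚ) ≤ L.greenbergKer κ.kerSubgroup) :
    RamifiedLineKummerEqAt W p :=
  fun κ hκ v hv L hL ↦ le_antisymm (hge κ hκ v hv L hL) (hle κ hκ v hv L hL)

/-- **`RamifiedLineKummerEqAt` from ONE ramified datum and the UNIQUENESS of the ramified line.**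
Hypotheses: (B2) any two ramified ordinary lines of `W` at a place `v ∋ p` have the same `plus`;
a ramified ordinary datum `L₀ v hv` at every `v ∋ p` (for a twist model of a good-ordinary curve:
`twistMap (reductionDatum V …) t`, `isRamifiedOrdinaryLine_twistMap`); for it, the inclusion
Greenberg ⟹ Kummer at level `ker κ` for every cyclotomic `κ` (team n1011 T-RD-Δ-K, seat p05:
`greenbergKer_twistMap_geomTransport_le_localKerOver`) and (B1) the converse. Then
`RamifiedLineKummerEqAt W p`. The bridge hypotheses of lead ruling R5-46, displayed; nothing asserted.
[folklore] -/
theorem ramifiedLineKummerEqAt_of_plus_unique_of_datum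
    (huniq : ∀ (v : HeightOneSpectrum (𝓞 ℚ)), ((p : ℕ) : 𝓞 ℚ) ∈ v.asIdeal →
      ∀ (L L' : LocalDatum ℚ (W.geomPrimaryTorsion p) v),
        IsRamifiedOrdinaryLine W p L → IsRamifiedOrdinaryLine W p L' → L.plus = L'.plus)
    (L₀ : ∀ (v : HeightOneSpectrum (𝓞 ℚ)), ((p : ℕ) : 𝓞 ℚ) ∈ v.asIdeal →
      LocalDatum ℚ (W.geomPrimaryTorsion p) v)
    (hL₀ : ∀ (v : HeightOneSpectrum (𝓞 ℚ)) (hv : ((p : ℕ) : 𝓞 ℚ) ∈ v.asIdeal),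
      IsRamifiedOrdinaryLine W p (L₀ v hv))
    (hge₀ : ∀ (κ : ZpExtension ℚ p), κ.IsCyclotomic →
      ∀ (v : HeightOneSpectrum (𝓞 ℚ)) (hv : ((p : ℕ) : 𝓞 ℚ) ∈ v.asIdeal),
        (L₀ v hv).greenbergKer κ.kerSubgroup ≤ W.localKerOver p κ.kerSubgroup (v.adicCompletion ℚ))
    (hle₀ : ∀ (κ : ZpExtension ℚ p), κ.IsCyclotomic →
      ∀ (v : HeightOneSpectrum (𝓞 ℚ)) (hv : ((p : ℕ) : 𝓞 ℚ) ∈ v.asIdeal),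
        W.localKerOver p κ.kerSubgroup (v.adicCompletion ℚ) ≤ (L₀ v hv).greenbergKer κ.kerSubgroup) :
    RamifiedLineKummerEqAt W p := by
  intro κ hκ v hv L hL
  have hLL₀ : L = L₀ v hv := LocalDatum.eq_of_plus_eq (huniq v hv L (L₀ v hv) hL (hL₀ v hv))
  rw [hLL₀]
  exact le_antisymm (hge₀ κ hκ v hv) (hle₀ κ hκ v hv)

/-- Conversely, `RamifiedLineKummerEqAt W p` gives back both inclusions for every ramified line — in
particular T-RD-Δ-K's `≤` for any ramified datum (consistency of currencies). [folklore] -/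
theorem RamifiedLineKummerEqAt.greenbergKer_le (h : RamifiedLineKummerEqAt W p) {κ : ZpExtension ℚ p}
    (hκ : κ.IsCyclotomic) {v : HeightOneSpectrum (𝓞 ℚ)} (hv : ((p : ℕ) : 𝓞 ℚ) ∈ v.asIdeal)
    {L : LocalDatum ℚ (W.geomPrimaryTorsion p) v} (hL : IsRamifiedOrdinaryLine W p L) :
    L.greenbergKer κ.kerSubgroup ≤ W.localKerOver p κ.kerSubgroup (v.adicCompletion ℚ) :=
  (h κ hκ v hv L hL).le

/-- … and the converse inclusion. [folklore] -/
theorem RamifiedLineKummerEqAt.localKerOver_le (h : RamifiedLineKummerEqAt W p) {κ : ZpExtension ℚ p}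
    (hκ : κ.IsCyclotomic) {v : HeightOneSpectrum (𝓞 ℚ)} (hv : ((p : ℕ) : 𝓞 ℚ) ∈ v.asIdeal)
    {L : LocalDatum ℚ (W.geomPrimaryTorsion p) v} (hL : IsRamifiedOrdinaryLine W p L) :
    W.localKerOver p κ.kerSubgroup (v.adicCompletion ℚ) ≤ L.greenbergKer κ.kerSubgroup :=
  (h κ hκ v hv L hL).ge

end Summit.BirchSwinnertonDyer.Rank1Residual.Additive

end
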